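import Summits.RiemannHypothesis.RiemannHypothesis.Theses.WeilGroundState
import Literature.NumberTheory.LFunctions.WeilWindowSuzukiProofs
import Literature.NumberTheory.LFunctions.WeilGroundStateRealZerosProofs
import HarnessLib

/-!
# Disproof of `GroundStateSimpleEven` (stmt-RiemannHypothesis-1526) — standing adversary, cycle 1

Crux (route WeilGroundState, rank 2):
`GroundStateSimpleEven := ∀ a > 0, WeilWindowSimpleEven a` (`Iff.rfl`, `groundStateSimpleEven_iff`):
for EVERY window `a > 0` the bottom `ε(a) = weilGroundEnergy a` of Weil's form `Re Q`, `Q g = W(g ⋆ g̃)`,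
on test functions supported in `[-a, a]` is a simple, isolated eigenvalue with EVEN eigenfunction —
variationally: some witness `φ` and `δ > 0` push every `L²`-normalised odd test function, and every
`L²`-normalised even one with `∫ conj φ · g = 0`, to `Re Q ≥ ε(a) + δ`.

## Findings (numbers, not adjectives)

* NO KILL. Verdict of this cycle: the crux resists cheap refutation AND cheap proof for the same reason —
  the `∀ a` clause is RH-strength (see `## Why it resists`).
* ELABORATION: rc 0; encoding junk-free (a non-`L²`/junk `φ` only enlarges the set of admissible even `g`,
  i.e. only hurts the prover; `ε(a)` is a genuine `sInf` of a nonempty bounded-below set for `a > 0`).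
* LOAD-BEARING HYPOTHESES (kernel-checked below, §2): the normalisation `∫‖g‖² = 1`, the parity/orthogonality
  disjunction and the support condition `tsupport g ⊆ [-a,a]` are each load-bearing
  (`groundStateSimpleEven_false_without_norm / _parity / _support`). `0 < a` and `0 < δ` are not
  (dropping `0 < a` adds only vacuous windows; with `δ = 0` the clause is the definition of `sInf`).
  `IsWeilTest` could only be attacked through junk integrals of non-test functions — not attempted.
* WITNESS STRUCTURE (§3): at every window at least one parity sector attains `ε(a)`
  (`bottom_attained_in_a_sector`); the witness `φ` must pair non-trivially with the even sector wherever the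
  even sector attains `ε(a)`: an ODD witness (in particular `φ = 0`) never works on `0 < a ≤ 1/100`
  (`not_windowClause_of_odd_witness`), because there the even sector attains `ε(a)` (`evenSector_attains`,
  from the tree's Suzuki gap) — and at EVERY window where the clause holds at all
  (`not_windowClause_of_odd_witness_of_weilWindowSimpleEven`); WLOG the witness is even
  (`windowClause_evenPart_witness`, junk-safe). KILL CRITERION for later refuters: one odd normalised trial function whose
  `Re Q` is `≤` that of every even normalised test function on the same window refutes the window clause
  (`not_weilWindowSimpleEven_of_odd_le_even`) — i.e. a certified Rayleigh quotient of ONE odd function below a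
  certified LOWER bound of the even sector. No such window exists numerically on the resolved range `a ≤ 1.0` (below).
* NATURAL STRENGTHENING REFUTED (§4): the parity-swapped statement "odd ground state"
  (`OddGroundState`) is false (`not_oddGroundState`, witness window `a = 1/100`).
* NUMERICS (kit jobs j016693 [smoke + validation], j016728/j016733 [grid], j016734 [convergence N=22/38],
  j017183 [ladder N=46/56/64 at a ≥ 0.9, 140 dps], j017497 [ladder2 N=60–76 at a = 1.05–1.2, 150 dps]; script `job1/main.py` in the disprover's folder; GEOMETRIC side — polar
  + primes + Bombieri archimedean term — so no zero-sum truncation; Rayleigh–Ritz with 2N Legendre polynomials ×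
  indicator of the window (inside the form domain), N = 30 per sector, 90 dps; normalisation validated against
  the zero side `2 Σ_γ G(γ)²` for a bump at `a = 1` to rel. 4e-12 with 100 zeros at 30 dps).
  Columns: even bottom e1, ratios to it of the odd bottom o1, the 2nd even level e2 and the mean-zero-even
  bottom m1 (= the line's φ = 1 hyperplane), `⟨u,1⟩` for the normalised even ground state u, its node count:
      a       e1          o1/e1   e2/e1   m1/e1   ⟨u,1⟩  nodes
      0.01    2.457       1.48    1.68    1.67    0.139  0
      0.05    0.9825      2.06    2.57    2.53    0.310  0
      0.1     0.4571      2.91    4.02    3.92    0.436  0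
      0.2     0.0949      6.69    12.2    11.6    0.607  0
      0.3     7.57e-3     29.4    103     91.6    0.716  0
      log2/2  1.3293e-3   55.0    497     413     0.742  0    (route-review float64: 1.329e-3, 0.0731, 0.661)
      0.4     1.814e-4    81.1    1693    1250    0.765  0
      0.5     9.35e-7     208     1.9e4   1.3e4   0.793  0
      0.6     1.62e-9     370     6.4e4   4.2e4   0.813  0
      log 2   7.70e-13    625     2.1e5   1.3e5   0.827  0    (N=22/30/38: 7.78/7.70/7.65e-13 — converged)
      0.75    3.76e-15    917     3.1e5   2.0e5   0.833  0
      log5/2  9.56e-18    1058    5.3e5   3.5e5   0.839  0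
      0.85    4.39e-20    1197    7.7e5   5.0e5   0.843  0    (converged to a factor ≲ 2)
      0.9     4.17e-23 (N=56; N=30: 5.7e-23)   o1/e1 = 1749   e2/e1 = 1.7e6   ⟨u,1⟩ 0.85  0
      1.0     5.98e-30 (N=56; N=46: 6.50e-30, N=38: 9.6e-30 — converged)  o1/e1 = 2569  e2/e1 = 3.8e6  ⟨u,1⟩ 0.85  0
      1.05    6.8e-34 (N=60)                                  o1/e1 = 2949   e2/e1 = 4.6e6   (j017497)
      1.1     2.05e-38 (N=68; N=56: 2.55e-38, N=46: 2.5e-37 — converged to ~20%)  o1/e1 = 3754  e2/e1 = 7.5e6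
      1.15    3.1e-43 (N=64)                                  o1/e1 = 4265   e2/e1 = 1.2e7
      1.2     8.1e-49 (N=76; N=64: 7.0e-48, N=56: 4.6e-46, N=46: 7.6e-42 — within a factor ≈ 3 of the law's
              2.5e-49)  o1/e1 = 693/3243/5612/6022 at N = 46/56/64/76: resolution only INCREASES the ratio.
  INTERLACING (the structural finding of this cycle): at EVERY window of the grid the merged low spectrum of
  the two sectors alternates in parity from the bottom, `even < odd < even < odd < …` (first 8 levels checked; the
  only exceptions are near-degenerate BULK levels ≈ 0.9 at a = 0.4 and 0.65, rungs 5–8, never the small ones;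
  e.g. a = log 2: 7.7e-13(e) 4.8e-10(o) 1.6e-7(e) 3.0e-5(o) 2.6e-3(e) 8.4e-2(o) 0.55(e) 0.84(o); a = 1.0,
  N = 38: 9.6e-30(e) 1.9e-26(o) 2.7e-23(e) 2.5e-20(o) 1.6e-17(e) 6.5e-15(o) 1.6e-12(e) 2.6e-10(o)), with a
  roughly constant ratio ≈ 10^{2.5}–10^{3.5} between consecutive rungs that grows with `a` — one prolate-like
  ladder indexed alternately by parity with the EVEN state at the bottom (Connes' picture; "odd block has one
  less small eigenvalue"). A parity crossing at the bottom would have to break this whole ladder.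
  Empirical law on the converged range: `ln e1(a) ≈ −4π e^{2a} + 9a + 15.8 (±0.4)` for a ∈ [0.5, 1.0] —
  Connes' `1 − χ` super-exponential decay. In words: on every resolved window the bottom is EVEN, SIMPLE
  (e2/e1 ≥ 1.7), the even ground state is strictly POSITIVE (no node, u(a⁻)/u(0) from 0.35 at a = 0.01 down to
  1.5e-14 at a = 1: prolate-like), NOT orthogonal to the constants (⟨u,1⟩ increases 0.14 → 0.85, so the line's
  witness φ = 1 is numerically sound with margin m1/e1 ≥ 1.67), and the parity ratio o1/e1 GROWS monotonically
  (1.48 at a = 0.01 → 2569 at a = 1.0 → ≈ 6000 at a = 1.2). Odd ground state: ‖o‖/‖∫o‖ = 4.69 (log2/2) ↘ 3.37 (a = 1) ≪ γ₁ = 14.13.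

## Why it resists (for the provers)

* B1 (ideator-1 barrier notes, confirmed here as the operative obstruction): under ¬RH an off-line quadruple
  makes the ORDER of the two sector bottoms oscillate in `a` with period `π/γ₀` once `a ≳ (log log γ₀)/(2η)`,
  so `∀ a` is RH-strength: no zero-blind structural lever (Perron–Frobenius, Beurling–Deny, rank-one secular
  equations, Hankel monotonicity) can prove it, and no unconditional refutation can come from large `a` either.
* B2 (precision wall): both sector bottoms are `< 1e-12` for `a ≥ 0.7` and decay super-exponentially
  (`e1(0.7) = 5.3e-13` here); a certified kill at a finite window needs a certified LOWER bound of the even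
  sector below the odd trial value — hopeless beyond `a ≈ 0.75`, and for `a ≤ 0.75` the numerics give
  o1/e1 ≥ 2 everywhere with the ratio increasing.
* Hence the only live refutation route is a parity CROSSING (or an even degeneracy) at a moderate window, and
  the scan excludes both on the resolved range a ∈ [0.01, 1.0] (ratios ≥ 1.48, resp. ≥ 1.68, growing); the
  only live proof routes are bounded-window certificates (items 1529/1531 style) plus an RH-strength input for
  large `a`.

## Line `Sketch` (lead's pick; declared dead by the lead at its cycle 1)

Its remaining stub `stub_meanZeroGap_of_hundredth_lt` (= crux at `a` + "ground state ⊄ 1^⊥") is numerically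
TRUE on the whole grid (m1/e1 ≥ 1.67, ⟨u,1⟩ ∈ [0.14, 0.85]), so it is not misstated; it is unprovable for the
B1/B2 reasons, exactly as the lead recorded. Nothing to kill there.

Everything conclusive below is `sorry`-free and is proposed under
`Summits/RiemannHypothesis/RiemannHypothesis/Theorems/GroundStateSimpleEven/Negative/`.
-/

noncomputable section

set_option linter.dupNamespace false

open Set MeasureTheory Filter
open scoped Real Topology ComplexConjugate

namespace Summit.RiemannHypothesis.RiemannHypothesis.Cruxes.GroundStateSimpleEven.Disproof

open Literature.NumberTheory.LFunctions
open Literature.NumberTheory.LFunctions.ConnesVanSuijlekom (gap_of_evenPart_orthogonal)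
open Summit.RiemannHypothesis.RiemannHypothesis.Theses.WeilGroundState

/-! ## 1. The crux unfolded, and the two basic tools -/

/-- The crux is literally `∀ a > 0, WeilWindowSimpleEven a`. [folklore] -/
theorem groundStateSimpleEven_iff :
    GroundStateSimpleEven ↔ ∀ a : ℝ, 0 < a → WeilWindowSimpleEven a :=
  Iff.rfl

/-- The integral over `ℝ` of an odd function vanishes (also when it is not integrable: then both
sides of `∫ F(-t) = -∫ F` are junk `0`). [folklore] -/
theorem integral_eq_zero_of_odd {F : ℝ → ℂ} (hF : ∀ t, F (-t) = -F t) : ∫ t, F t = 0 := by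
  have h1 : ∫ x : ℝ, F (-x) = ∫ x : ℝ, F x := integral_neg_eq_self F volume
  have h2 : ∫ x : ℝ, F (-x) = -∫ x : ℝ, F x := by
    simp_rw [hF]
    exact integral_neg F
  linear_combination (h1.symm.trans h2) / 2

/-- **`ε(a)` is approached on the sphere**: for `a > 0` and `δ > 0` some normalised window test
function has `Re Q(g) < ε(a) + δ` (the sphere is nonempty, `exists_isWeilTest_sphere`; no lower
bound is needed for this direction of `sInf`). [folklore] -/
theorem exists_sphere_lt {a δ : ℝ} (ha : 0 < a) (hδ : 0 < δ) :
    ∃ g : ℝ → ℂ, IsWeilTest g ∧ tsupport g ⊆ Icc (-a) a ∧ ∫ t, ‖g t‖ ^ 2 = (1 : ℝ) ∧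
      (weilQuadratic g).re < weilGroundEnergy a + δ := by
  set S : Set ℝ := {x : ℝ | ∃ g : ℝ → ℂ, IsWeilTest g ∧ tsupport g ⊆ Icc (-a) a ∧
    ∫ t : ℝ, ‖g t‖ ^ 2 = 1 ∧ x = (weilQuadratic g).re} with hS
  have hε : weilGroundEnergy a = sInf S := rfl
  have hne : S.Nonempty := by
    obtain ⟨g, hg, hsupp, hnorm⟩ := exists_isWeilTest_sphere ha
    exact ⟨_, g, hg, hsupp, hnorm, rfl⟩
  have hlt : sInf S < weilGroundEnergy a + δ := by
    rw [← hε]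
    linarith
  obtain ⟨x, ⟨g, hg, hsupp, hnorm, rfl⟩, hx⟩ := exists_lt_of_csInf_lt hne hlt
  exact ⟨g, hg, hsupp, hnorm, hx⟩

/-- **No gap on the whole sphere**: it is impossible that `(ε(a) + δ)‖k‖² ≤ Re Q(k)` for all window
test functions with `δ > 0` (apply it to a `g` of the sphere with `Re Q(g) < ε(a) + δ`). [folklore] -/
theorem not_gap_on_sphere {a δ : ℝ} (ha : 0 < a) (hδ : 0 < δ)
    (h : ∀ k : ℝ → ℂ, IsWeilTest k → tsupport k ⊆ Icc (-a) a →
      (weilGroundEnergy a + δ) * ∫ t, ‖k t‖ ^ 2 ≤ (weilQuadratic k).re) : False := by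
  obtain ⟨g, hg, hs, hn, hlt⟩ := exists_sphere_lt ha hδ
  have := h g hg hs
  rw [hn, mul_one] at this
  linarith

/-- **Sector gaps add up to a gap on the whole sphere** (parity splitting of `Re Q` and of `‖·‖²`,
packaged in the tree as `gap_of_evenPart_orthogonal` with the witness `φ = 0`): if odd AND even
normalised window test functions both lie `≥ ε(a) + δ`, then `(ε(a) + δ)‖k‖² ≤ Re Q(k)` for every
window test function `k`. [folklore] -/
theorem gap_on_sphere_of_sector_gaps {a δ : ℝ}
    (hodd : ∀ g : ℝ → ℂ, IsWeilTest g → tsupport g ⊆ Icc (-a) a → ∫ t, ‖g t‖ ^ 2 = (1 : ℝ) →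
      (∀ t, g (-t) = -g t) → weilGroundEnergy a + δ ≤ (weilQuadratic g).re)
    (heven : ∀ g : ℝ → ℂ, IsWeilTest g → tsupport g ⊆ Icc (-a) a → ∫ t, ‖g t‖ ^ 2 = (1 : ℝ) →
      (∀ t, g (-t) = g t) → weilGroundEnergy a + δ ≤ (weilQuadratic g).re) :
    ∀ k : ℝ → ℂ, IsWeilTest k → tsupport k ⊆ Icc (-a) a →
      (weilGroundEnergy a + δ) * ∫ t, ‖k t‖ ^ 2 ≤ (weilQuadratic k).re := by
  intro k hk hks
  have hH : ∀ g : ℝ → ℂ, IsWeilTest g → tsupport g ⊆ Icc (-a) a → ∫ t, ‖g t‖ ^ 2 = (1 : ℝ) →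
      ((∀ t, g (-t) = -g t) ∨ ((∀ t, g (-t) = g t) ∧ ∫ t, conj ((0 : ℝ → ℂ) t) * g t = 0)) →
        weilGroundEnergy a + δ ≤ (weilQuadratic g).re := fun g hg hs hn hpar ↦
    hpar.elim (hodd g hg hs hn) (fun h ↦ heven g hg hs hn h.1)
  exact gap_of_evenPart_orthogonal hH hk hks (by simp)

/-! ## 2. Load-bearing hypotheses: the crux with one hypothesis deleted is FALSE -/

/-- The crux with the normalisation `∫‖g‖² = 1` deleted. -/
def GroundStateSimpleEvenWithoutNorm : Prop :=
  ∀ a : ℝ, 0 < a → ∃ φ : ℝ → ℂ, ∃ δ : ℝ, 0 < δ ∧ ∀ g : ℝ → ℂ, IsWeilTest g →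
    tsupport g ⊆ Icc (-a) a →
      ((∀ t, g (-t) = -g t) ∨ ((∀ t, g (-t) = g t) ∧ ∫ t, starRingEnd ℂ (φ t) * g t = 0)) →
        weilGroundEnergy a + δ ≤ (weilQuadratic g).re

/-- **Any proof must use the normalisation**: without it `g = 0` (odd, `Q(0) = 0`) is admissible, but
`ε(a) > 0` on small windows (`exists_weilGroundEnergy_pos`, Bombieri/Yoshida coercivity in the tree).
[folklore] -/
theorem groundStateSimpleEven_false_without_norm : ¬ GroundStateSimpleEvenWithoutNorm := by
  intro h
  obtain ⟨a₁, ha₁, hpos⟩ := exists_weilGroundEnergy_pos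
  obtain ⟨φ, δ, hδ, hcl⟩ := h a₁ ha₁
  have ht : IsWeilTest (0 : ℝ → ℂ) := ⟨contDiff_const, HasCompactSupport.zero⟩
  have hs : tsupport (0 : ℝ → ℂ) ⊆ Icc (-a₁) a₁ := by
    rw [tsupport_eq_empty_iff.2 rfl]
    exact empty_subset _
  have h0 := hcl 0 ht hs (Or.inl fun t ↦ by simp)
  rw [weilQuadratic_zero, Complex.zero_re] at h0
  linarith [hpos a₁ ha₁ le_rfl]

/-- The crux with the parity/orthogonality disjunction deleted (the witness `φ` is then idle). -/
def GroundStateSimpleEvenWithoutParity : Prop :=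
  ∀ a : ℝ, 0 < a → ∃ _φ : ℝ → ℂ, ∃ δ : ℝ, 0 < δ ∧ ∀ g : ℝ → ℂ, IsWeilTest g →
    tsupport g ⊆ Icc (-a) a → ∫ t, ‖g t‖ ^ 2 = (1 : ℝ) →
      weilGroundEnergy a + δ ≤ (weilQuadratic g).re

/-- **Any proof must use the parity/orthogonality hypothesis**: without it the clause says the whole
sphere lies `≥ ε(a) + δ`, contradicting the definition of `ε(a)` as an infimum over a nonempty set
(witness window `a = 1`). [folklore] -/
theorem groundStateSimpleEven_false_without_parity : ¬ GroundStateSimpleEvenWithoutParity := by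
  intro h
  obtain ⟨-, δ, hδ, hcl⟩ := h 1 one_pos
  obtain ⟨g, hg, hsupp, hnorm, hlt⟩ := exists_sphere_lt one_pos hδ
  linarith [hcl g hg hsupp hnorm]

/-- The crux with the support condition `tsupport g ⊆ [-a, a]` deleted. -/
def GroundStateSimpleEvenWithoutSupport : Prop :=
  ∀ a : ℝ, 0 < a → ∃ φ : ℝ → ℂ, ∃ δ : ℝ, 0 < δ ∧ ∀ g : ℝ → ℂ, IsWeilTest g →
    ∫ t, ‖g t‖ ^ 2 = (1 : ℝ) →
      ((∀ t, g (-t) = -g t) ∨ ((∀ t, g (-t) = g t) ∧ ∫ t, starRingEnd ℂ (φ t) * g t = 0)) →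
        weilGroundEnergy a + δ ≤ (weilQuadratic g).re

/-- **An odd normalised test function exists** (two far-apart translates `g(t - 3) - g(-t - 3)` of an
element of the unit sphere of the window `[-1, 1]`, rescaled by `1/√2`; the translates have disjoint
supports, so the norms add). [folklore] -/
theorem exists_odd_sphere :
    ∃ o : ℝ → ℂ, IsWeilTest o ∧ (∀ t, o (-t) = -o t) ∧ ∫ t, ‖o t‖ ^ 2 = (1 : ℝ) := by
  obtain ⟨g, hg, hsupp, hnorm⟩ := exists_isWeilTest_sphere one_pos
  set g₁ : ℝ → ℂ := fun t ↦ g (t + (-3)) with hg₁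
  set g₂ : ℝ → ℂ := fun t ↦ g₁ (-t) with hg₂
  have hg₁t : IsWeilTest g₁ := isWeilTest_translate hg (-3)
  have hg₂t : IsWeilTest g₂ := hg₁t.comp_neg
  set c : ℝ := (Real.sqrt 2)⁻¹ with hc
  have hcpos : 0 < c := inv_pos.2 (Real.sqrt_pos.2 two_pos)
  have hcsq : c ^ 2 = 1 / 2 := by
    rw [hc, inv_pow, Real.sq_sqrt (by norm_num : (0 : ℝ) ≤ 2), one_div]
  set o : ℝ → ℂ := fun t ↦ (c : ℂ) * ((g₁ + fun t ↦ (-1 : ℂ) * g₂ t) t) with ho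
  have hot : IsWeilTest o := (hg₁t.add (hg₂t.const_mul (-1))).const_mul c
  -- the two translates never overlap
  have hzero : ∀ t : ℝ, g₁ t = 0 ∨ g₂ t = 0 := by
    intro t
    by_cases ht : t ≤ 0
    · left
      show g (t + (-3)) = 0
      refine image_eq_zero_of_notMem_tsupport fun hmem ↦ ?_
      have := hsupp hmem
      simp only [mem_Icc] at this
      linarith [this.1]
    · right
      show g (-t + (-3)) = 0
      refine image_eq_zero_of_notMem_tsupport fun hmem ↦ ?_
      have := hsupp hmem
      simp only [mem_Icc] at this
      linarith [this.1]
  have hpt : ∀ t : ℝ, ‖o t‖ ^ 2 = (1 / 2 : ℝ) * (‖g₁ t‖ ^ 2 + ‖g₂ t‖ ^ 2) := by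
    intro t
    have e1 : o t = (c : ℂ) * (g₁ t - g₂ t) := by
      simp only [ho, Pi.add_apply]
      ring
    rw [e1, norm_mul, mul_pow, Complex.norm_real, Real.norm_of_nonneg hcpos.le, hcsq]
    rcases hzero t with h0 | h0 <;> simp [h0]
  refine ⟨o, hot, fun t ↦ ?_, ?_⟩
  · simp only [ho, Pi.add_apply, hg₂, neg_neg]
    ring
  · simp_rw [hpt]
    rw [integral_const_mul, integral_add hg₁t.integrable_norm_sq hg₂t.integrable_norm_sq]
    have h1 : ∫ t, ‖g₁ t‖ ^ 2 = 1 := by rw [hg₁, integral_norm_sq_translate, hnorm]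
    have h2 : ∫ t, ‖g₂ t‖ ^ 2 = 1 := by
      rw [← h1]
      exact integral_neg_eq_self (fun t ↦ ‖g₁ t‖ ^ 2) volume
    rw [h1, h2]
    norm_num

/-- **Any proof must use the support condition**: a FIXED odd normalised test function `o` (any
support) has a fixed energy `q = Re Q(o)`, while `ε(a) → +∞` as `a → 0⁺` (Bombieri's coercivity
`weilQuadratic_coercive` in the tree): at a window `a₀` with `ε(a₀) ≥ q + 1` the support-free clause
fails for `o`. [folklore] -/
theorem groundStateSimpleEven_false_without_support : ¬ GroundStateSimpleEvenWithoutSupport := by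
  intro h
  obtain ⟨o, hot, hodd, hon⟩ := exists_odd_sphere
  set q : ℝ := (weilQuadratic o).re with hq
  obtain ⟨a₀, ha₀, hco⟩ := weilQuadratic_coercive (q + 1)
  have hne : {x : ℝ | ∃ g : ℝ → ℂ, IsWeilTest g ∧ tsupport g ⊆ Icc (-a₀) a₀ ∧
      ∫ t : ℝ, ‖g t‖ ^ 2 = 1 ∧ x = (weilQuadratic g).re}.Nonempty := by
    obtain ⟨g, hg, hsupp, hnorm⟩ := exists_isWeilTest_sphere ha₀
    exact ⟨_, g, hg, hsupp, hnorm, rfl⟩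
  have hε : q + 1 ≤ weilGroundEnergy a₀ := by
    refine le_csInf hne ?_
    rintro x ⟨g, hg, hs, hn, rfl⟩
    have := hco a₀ ha₀ le_rfl g hg hs
    rwa [hn, mul_one] at this
  obtain ⟨φ, δ, hδ, hcl⟩ := h a₀ ha₀
  have := hcl o hot hon (Or.inl hodd)
  linarith

/-! ## 3. Structure of the witness; the kill criterion -/

/-- **At every window at least one parity sector attains `ε(a)`**: there is no `δ > 0` with both the
odd and the even normalised window test functions `≥ ε(a) + δ` (so the strengthening of the crux with
the witness-free even branch — "both sectors gapped" — is false at EVERY window). [folklore] -/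
theorem bottom_attained_in_a_sector {a δ : ℝ} (ha : 0 < a) (hδ : 0 < δ)
    (hodd : ∀ g : ℝ → ℂ, IsWeilTest g → tsupport g ⊆ Icc (-a) a → ∫ t, ‖g t‖ ^ 2 = (1 : ℝ) →
      (∀ t, g (-t) = -g t) → weilGroundEnergy a + δ ≤ (weilQuadratic g).re)
    (heven : ∀ g : ℝ → ℂ, IsWeilTest g → tsupport g ⊆ Icc (-a) a → ∫ t, ‖g t‖ ^ 2 = (1 : ℝ) →
      (∀ t, g (-t) = g t) → weilGroundEnergy a + δ ≤ (weilQuadratic g).re) : False :=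
  not_gap_on_sphere ha hδ (gap_on_sphere_of_sector_gaps hodd heven)

/-- **KILL CRITERION.** The window clause at `a > 0` is refuted by ONE odd normalised window test
function `o` whose energy is `≤` that of every even normalised window test function: then the odd
branch of the clause puts `o` at `≥ ε(a) + δ`, the even sector follows, and both sectors would be
gapped. (What a certified refutation must produce: an upper bound for one odd Rayleigh quotient below a
LOWER bound for the whole even sector.) [folklore] -/
theorem not_weilWindowSimpleEven_of_odd_le_even {a : ℝ} (ha : 0 < a) {o : ℝ → ℂ}
    (ho : IsWeilTest o) (hos : tsupport o ⊆ Icc (-a) a) (hon : ∫ t, ‖o t‖ ^ 2 = (1 : ℝ))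
    (hodd : ∀ t, o (-t) = -o t)
    (hle : ∀ e : ℝ → ℂ, IsWeilTest e → tsupport e ⊆ Icc (-a) a → ∫ t, ‖e t‖ ^ 2 = (1 : ℝ) →
      (∀ t, e (-t) = e t) → (weilQuadratic o).re ≤ (weilQuadratic e).re) :
    ¬ WeilWindowSimpleEven a := by
  rintro ⟨φ, δ, hδ, hH⟩
  have hoδ : weilGroundEnergy a + δ ≤ (weilQuadratic o).re := hH o ho hos hon (Or.inl hodd)
  refine bottom_attained_in_a_sector ha hδ (fun g hg hs hn hg' ↦ hH g hg hs hn (Or.inl hg'))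
    fun e he hes hen hev ↦ hoδ.trans (hle e he hes hen hev)

/-- **Kill criterion at crux level**: one window `a > 0` carrying an odd normalised window test function
below the whole even sector refutes `GroundStateSimpleEven`. (No such window is known; numerically none on
`[0.01, 1.0]`.) [folklore] -/
theorem groundStateSimpleEven_false_of_odd_le_even {a : ℝ} (ha : 0 < a) {o : ℝ → ℂ}
    (ho : IsWeilTest o) (hos : tsupport o ⊆ Icc (-a) a) (hon : ∫ t, ‖o t‖ ^ 2 = (1 : ℝ))
    (hodd : ∀ t, o (-t) = -o t)
    (hle : ∀ e : ℝ → ℂ, IsWeilTest e → tsupport e ⊆ Icc (-a) a → ∫ t, ‖e t‖ ^ 2 = (1 : ℝ) →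
      (∀ t, e (-t) = e t) → (weilQuadratic o).re ≤ (weilQuadratic e).re) :
    ¬ GroundStateSimpleEven := fun h ↦
  not_weilWindowSimpleEven_of_odd_le_even ha ho hos hon hodd hle (h a ha)

/-- **The even sector attains `ε(a)` on Suzuki's windows** `0 < a ≤ 1/100`: for every `δ > 0` some
EVEN normalised window test function has `Re Q < ε(a) + δ` (the tree's mean-zero gap
`weilGroundEnergy_add_le_of_integral_eq_zero` puts the odd sector `≥ ε(a) + 1/10`, and both sectors
cannot be gapped). [cite: Suzuki2026, Thm. 1.4] -/
theorem evenSector_attains {a δ : ℝ} (ha : 0 < a) (ha' : a ≤ 1 / 100) (hδ : 0 < δ) :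
    ∃ e : ℝ → ℂ, IsWeilTest e ∧ tsupport e ⊆ Icc (-a) a ∧ ∫ t, ‖e t‖ ^ 2 = (1 : ℝ) ∧
      (∀ t, e (-t) = e t) ∧ (weilQuadratic e).re < weilGroundEnergy a + δ := by
  by_contra hne
  have hne' : ∀ e : ℝ → ℂ, IsWeilTest e → tsupport e ⊆ Icc (-a) a → ∫ t, ‖e t‖ ^ 2 = (1 : ℝ) →
      (∀ t, e (-t) = e t) → weilGroundEnergy a + δ ≤ (weilQuadratic e).re :=
    fun e he hes hen hev ↦ not_lt.1 fun hlt ↦ hne ⟨e, he, hes, hen, hev, hlt⟩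
  have hδ' : 0 < min δ (1 / 10) := lt_min hδ (by norm_num)
  refine bottom_attained_in_a_sector ha hδ' (fun g hg hs hn hodd ↦ ?_) fun g hg hs hn hev ↦ ?_
  · have hmean : ∫ x : ℝ, g x = 0 := integral_eq_zero_of_odd hodd
    have := weilGroundEnergy_add_le_of_integral_eq_zero hg ha ha' hs hn hmean
    linarith [min_le_right δ (1 / 10)]
  · linarith [hne' g hg hs hn hev, min_le_left δ (1 / 10)]

/-- **The witness must see the even sector**: on `0 < a ≤ 1/100` NO odd `φ` (in particular not
`φ = 0`) can serve as the witness of the window clause, whatever `δ > 0`: every even `g` is then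
automatically "orthogonal" to `φ` (odd integrand), and the even sector attains `ε(a)`. Provers: the
`∃ φ` is load-bearing through its even part's pairing with the ground state (the line's `φ = 1` is fine
numerically: `⟨u,1⟩ ∈ [0.3, 0.85]` on the whole scanned grid). [folklore] -/
theorem not_windowClause_of_odd_witness {a δ : ℝ} (ha : 0 < a) (ha' : a ≤ 1 / 100) (hδ : 0 < δ)
    {φ : ℝ → ℂ} (hφ : ∀ t, φ (-t) = -φ t) :
    ¬ ∀ g : ℝ → ℂ, IsWeilTest g → tsupport g ⊆ Icc (-a) a → ∫ t, ‖g t‖ ^ 2 = (1 : ℝ) →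
        ((∀ t, g (-t) = -g t) ∨ ((∀ t, g (-t) = g t) ∧ ∫ t, starRingEnd ℂ (φ t) * g t = 0)) →
          weilGroundEnergy a + δ ≤ (weilQuadratic g).re := by
  intro hH
  obtain ⟨e, he, hes, hen, hev, hlt⟩ := evenSector_attains ha ha' hδ
  have horth : ∫ t, starRingEnd ℂ (φ t) * e t = 0 :=
    integral_eq_zero_of_odd fun t ↦ by rw [hφ, hev, map_neg, neg_mul]
  linarith [hH e he hes hen (Or.inr ⟨hev, horth⟩)]

/-- **Wherever the window clause holds at all, the even sector attains `ε(a)`**: the clause gaps the odd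
sector, and both sectors cannot be gapped (`bottom_attained_in_a_sector`). So at every window where the
crux is TRUE its infimum is carried by even functions. [folklore] -/
theorem evenSector_attains_of_weilWindowSimpleEven {a δ : ℝ} (ha : 0 < a)
    (hW : WeilWindowSimpleEven a) (hδ : 0 < δ) :
    ∃ e : ℝ → ℂ, IsWeilTest e ∧ tsupport e ⊆ Icc (-a) a ∧ ∫ t, ‖e t‖ ^ 2 = (1 : ℝ) ∧
      (∀ t, e (-t) = e t) ∧ (weilQuadratic e).re < weilGroundEnergy a + δ := by
  by_contra hne
  have hne' : ∀ e : ℝ → ℂ, IsWeilTest e → tsupport e ⊆ Icc (-a) a → ∫ t, ‖e t‖ ^ 2 = (1 : ℝ) →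
      (∀ t, e (-t) = e t) → weilGroundEnergy a + δ ≤ (weilQuadratic e).re :=
    fun e he hes hen hev ↦ not_lt.1 fun hlt ↦ hne ⟨e, he, hes, hen, hev, hlt⟩
  obtain ⟨φ, δ₀, hδ₀, hH⟩ := hW
  have hδ' : 0 < min δ δ₀ := lt_min hδ hδ₀
  refine bottom_attained_in_a_sector ha hδ' (fun g hg hs hn hodd ↦ ?_) fun g hg hs hn hev ↦ ?_
  · linarith [hH g hg hs hn (Or.inl hodd), min_le_right δ δ₀]
  · linarith [hne' g hg hs hn hev, min_le_left δ δ₀]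

/-- **At every window where the clause holds, no odd witness works** (generalises
`not_windowClause_of_odd_witness` from Suzuki's windows to all windows where the crux is true): the
`∃ φ` of the crux is load-bearing exactly through the pairing of `φ` with the even sector. [folklore] -/
theorem not_windowClause_of_odd_witness_of_weilWindowSimpleEven {a δ : ℝ} (ha : 0 < a)
    (hW : WeilWindowSimpleEven a) (hδ : 0 < δ) {φ : ℝ → ℂ} (hφ : ∀ t, φ (-t) = -φ t) :
    ¬ ∀ g : ℝ → ℂ, IsWeilTest g → tsupport g ⊆ Icc (-a) a → ∫ t, ‖g t‖ ^ 2 = (1 : ℝ) →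
        ((∀ t, g (-t) = -g t) ∨ ((∀ t, g (-t) = g t) ∧ ∫ t, starRingEnd ℂ (φ t) * g t = 0)) →
          weilGroundEnergy a + δ ≤ (weilQuadratic g).re := by
  intro hH
  obtain ⟨e, he, hes, hen, hev, hlt⟩ := evenSector_attains_of_weilWindowSimpleEven ha hW hδ
  have horth : ∫ t, starRingEnd ℂ (φ t) * e t = 0 :=
    integral_eq_zero_of_odd fun t ↦ by rw [hφ, hev, map_neg, neg_mul]
  linarith [hH e he hes hen (Or.inr ⟨hev, horth⟩)]

/-- **Crux level**: `GroundStateSimpleEven` forces the even sector to carry the infimum at EVERY window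
(so a single window whose infimum is NOT approached by even functions refutes it — the degenerate-bottom
variant of the kill criterion). [folklore] -/
theorem evenSector_attains_of_groundStateSimpleEven (h : GroundStateSimpleEven) {a δ : ℝ} (ha : 0 < a)
    (hδ : 0 < δ) :
    ∃ e : ℝ → ℂ, IsWeilTest e ∧ tsupport e ⊆ Icc (-a) a ∧ ∫ t, ‖e t‖ ^ 2 = (1 : ℝ) ∧
      (∀ t, e (-t) = e t) ∧ (weilQuadratic e).re < weilGroundEnergy a + δ :=
  evenSector_attains_of_weilWindowSimpleEven ha (h a ha) hδ

/-- **The witness pairs with every even near-ground state**: under the window clause with witness `φ` and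
gap `δ`, an even normalised window test function of energy `< ε(a) + δ` has `∫ conj φ · e ≠ 0` (and such
`e` exist for every `δ` wherever the clause holds, `evenSector_attains_of_weilWindowSimpleEven`). [folklore] -/
theorem pairing_ne_zero_of_lt {a δ : ℝ} {φ : ℝ → ℂ}
    (hH : ∀ g : ℝ → ℂ, IsWeilTest g → tsupport g ⊆ Icc (-a) a → ∫ t, ‖g t‖ ^ 2 = (1 : ℝ) →
      ((∀ t, g (-t) = -g t) ∨ ((∀ t, g (-t) = g t) ∧ ∫ t, starRingEnd ℂ (φ t) * g t = 0)) →
        weilGroundEnergy a + δ ≤ (weilQuadratic g).re)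
    {e : ℝ → ℂ} (he : IsWeilTest e) (hes : tsupport e ⊆ Icc (-a) a) (hen : ∫ t, ‖e t‖ ^ 2 = (1 : ℝ))
    (hev : ∀ t, e (-t) = e t) (hlt : (weilQuadratic e).re < weilGroundEnergy a + δ) :
    ∫ t, starRingEnd ℂ (φ t) * e t ≠ 0 := fun h0 ↦
  (not_le.2 hlt) (hH e he hes hen (Or.inr ⟨hev, h0⟩))

/-! ### WLOG the witness is even -/

/-- Pairing with the even part of the witness equals pairing with the witness, for even `g` and an
integrable pairing. [folklore] -/
theorem integral_conj_evenPart_mul_of_even {φ g : ℝ → ℂ} (hev : ∀ t, g (-t) = g t)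
    (hint : Integrable fun t ↦ starRingEnd ℂ (φ t) * g t) :
    ∫ t, starRingEnd ℂ ((φ t + φ (-t)) / 2) * g t = ∫ t, starRingEnd ℂ (φ t) * g t := by
  have hint' : Integrable fun t ↦ starRingEnd ℂ (φ (-t)) * g t := by
    have h := hint.comp_neg
    refine h.congr (Eventually.of_forall fun t ↦ ?_)
    simp only [hev]
  have hswap : ∫ t, starRingEnd ℂ (φ (-t)) * g t = ∫ t, starRingEnd ℂ (φ t) * g t := by
    have h := integral_neg_eq_self (fun t ↦ starRingEnd ℂ (φ t) * g t) volume
    simp only [hev] at h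
    exact h
  have e1 : (fun t ↦ starRingEnd ℂ ((φ t + φ (-t)) / 2) * g t) =
      fun t ↦ (1 / 2 : ℂ) * (starRingEnd ℂ (φ t) * g t) +
        (1 / 2 : ℂ) * (starRingEnd ℂ (φ (-t)) * g t) := by
    funext t
    simp only [map_add, map_div₀, map_ofNat]
    ring
  rw [e1, integral_add (hint.const_mul _) (hint'.const_mul _), integral_const_mul, integral_const_mul,
    hswap]
  ring

/-- **WLOG the witness is even** (junk-safe): if the window clause holds with witness `φ` and gap `δ`,
it holds with the even part `(φ + φ(-·))/2` and the same `δ`. For an even `g` orthogonal to the even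
part: either `conj φ · g` is integrable, and then `∫ conj φ · g` equals the pairing with the even part
(the odd part pairs to `0`), or it is not, and then `∫ conj φ · g = 0` by convention — in both cases `g`
was already admissible for `φ`. [folklore] -/
theorem windowClause_evenPart_witness {a δ : ℝ} {φ : ℝ → ℂ}
    (hH : ∀ g : ℝ → ℂ, IsWeilTest g → tsupport g ⊆ Icc (-a) a → ∫ t, ‖g t‖ ^ 2 = (1 : ℝ) →
      ((∀ t, g (-t) = -g t) ∨ ((∀ t, g (-t) = g t) ∧ ∫ t, starRingEnd ℂ (φ t) * g t = 0)) →
        weilGroundEnergy a + δ ≤ (weilQuadratic g).re) :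
    ∀ g : ℝ → ℂ, IsWeilTest g → tsupport g ⊆ Icc (-a) a → ∫ t, ‖g t‖ ^ 2 = (1 : ℝ) →
      ((∀ t, g (-t) = -g t) ∨
        ((∀ t, g (-t) = g t) ∧ ∫ t, starRingEnd ℂ ((φ t + φ (-t)) / 2) * g t = 0)) →
        weilGroundEnergy a + δ ≤ (weilQuadratic g).re := by
  intro g hg hs hn hpar
  rcases hpar with hodd | ⟨hev, horth⟩
  · exact hH g hg hs hn (Or.inl hodd)
  · refine hH g hg hs hn (Or.inr ⟨hev, ?_⟩)
    by_cases hint : Integrable fun t ↦ starRingEnd ℂ (φ t) * g t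
    · rw [← integral_conj_evenPart_mul_of_even hev hint]
      exact horth
    · exact integral_undef hint

/-- Hence `WeilWindowSimpleEven a` always has an EVEN witness. [folklore] -/
theorem exists_even_witness_of_weilWindowSimpleEven {a : ℝ} (h : WeilWindowSimpleEven a) :
    ∃ φ : ℝ → ℂ, (∀ t, φ (-t) = φ t) ∧ ∃ δ : ℝ, 0 < δ ∧
      ∀ g : ℝ → ℂ, IsWeilTest g → tsupport g ⊆ Icc (-a) a → ∫ t, ‖g t‖ ^ 2 = (1 : ℝ) →
        ((∀ t, g (-t) = -g t) ∨ ((∀ t, g (-t) = g t) ∧ ∫ t, starRingEnd ℂ (φ t) * g t = 0)) →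
          weilGroundEnergy a + δ ≤ (weilQuadratic g).re := by
  obtain ⟨φ, δ, hδ, hH⟩ := h
  refine ⟨fun t ↦ (φ t + φ (-t)) / 2, fun t ↦ ?_, δ, hδ, windowClause_evenPart_witness hH⟩
  simp only [neg_neg]
  ring

/-! ## 4. A natural strengthening / variant refuted: the parity-swapped crux -/

/-- The parity-swapped crux: "the bottom is simple and ODD" — even normalised test functions, and odd
ones orthogonal to a witness, lie `≥ ε(a) + δ`. -/
def OddGroundState : Prop :=
  ∀ a : ℝ, 0 < a → ∃ φ : ℝ → ℂ, ∃ δ : ℝ, 0 < δ ∧ ∀ g : ℝ → ℂ, IsWeilTest g →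
    tsupport g ⊆ Icc (-a) a → ∫ t, ‖g t‖ ^ 2 = (1 : ℝ) →
      ((∀ t, g (-t) = g t) ∨ ((∀ t, g (-t) = -g t) ∧ ∫ t, starRingEnd ℂ (φ t) * g t = 0)) →
        weilGroundEnergy a + δ ≤ (weilQuadratic g).re

/-- **The parity-swapped crux is false** (witness window `a = 1/100`, where the even sector attains
`ε(a)`): parity is not a symmetric bookkeeping choice in this problem — the even sector wins on small
windows (Suzuki), and numerically on every probed window up to `a = 1.2`. [cite: Suzuki2026, Thm. 1.4] -/
theorem not_oddGroundState : ¬ OddGroundState := by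
  intro h
  obtain ⟨φ, δ, hδ, hcl⟩ := h (1 / 100) (by norm_num)
  obtain ⟨e, he, hes, hen, hev, hlt⟩ := evenSector_attains (a := 1 / 100) (by norm_num) le_rfl hδ
  linarith [hcl e he hes hen (Or.inl hev)]

/-! ## 5. Targets (line `Sketch`)

The lead's only open stub, `stub_meanZeroGap_of_hundredth_lt (a) (ha : 1/100 < a) : ∃ δ > 0, ∀ g …,
∫ g = 0 → ε(a) + δ ≤ Re Q g`, is the crux at `a` plus "the ground state is not orthogonal to `1`".
Numerically both hold on the whole grid (m1/e1 ≥ 2.5, ⟨u,1⟩ ≥ 0.3): NOT misstated, merely RH-strength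
as a `∀ a` statement (B1) and beyond certified reach for `a ≳ 0.75` (B2). No `stub_false` is filed.
The localisation hypothesis `hloc` of the lead's conditional closure `meanZeroGap_of_RH_of_localised`
(Poincaré ratio `‖h'‖²/‖h‖² ≤ Λ < γ₁²` for near-null derivatives) is vacuous-or-true wherever the stub
holds and cannot be attacked independently of it; for the odd ground state the ratio is far inside
(`√ratio = 4.69` at log2/2, `3.59` at 0.7, vs `γ₁ = 14.13`).
-/

end Summit.RiemannHypothesis.RiemannHypothesis.Cruxes.GroundStateSimpleEven.Disproof

end
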